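import Summits.QuantumFields.YangMills.Theorems.LuscherReductionTwistedTraceScalingBTDiagonalIntegral
import Summits.QuantumFields.YangMills.Theorems.FlatTubeReductionExpMomentSandwich
import HarnessLib

/-!
# (L3) AT RATE GRADE: the diagonal factor `f(u) = fpBOKernel β Ω W u u / K₁^{(L³β)}(u,u)` is `f(1)·(1 ± (m₂ + m_R))` from MOMENTS of the reference density — no sup bounds,
# no logarithms (route `FlatTubeReduction`, crux K1 `NearFlatRatioLaw` stmt-QuantumFields-24720; seat `ym-line-ftr-p1` g12; rate twin «ratepack-v3 / frozen fibres»;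
# R2b1 RECORD rung — no summit statement is proved here)

WHY (memo `Cruxes/NearFlatRatioLaw/Lines/ratepack-v3-frozen-g12.md` §5.4).  RED lane A's `fpBOKernel_diag_two_sided` (p661092) sandwiches `f(u)/f(1)` by SUP bounds `ε₁, ε₂` of the
exact exponent difference `diagX` over the support of the profile; sups over a fibre support of radius `β^{-1/2}log β` (and the crude magnetic remainder `β·stepActionErr`) put
logarithms / `β^{-1/2}`-junk into the two-sidedness constant `κ_W` of the exact dressing `W² = f(u)/f(1)`, which the rate twin cannot afford at its core exponent `s = 1/6`.
THIS FILE is the same assembly with the Haar sandwich replaced by the MOMENT sandwich `integral_exp_moment_sandwich` (p676445), pointwise in the fibre/gauge datum `p = (v,v',g)`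
and then integrated against the reference density `ρ₁(p) = fpTriple β Ω W 1 1 p`:
  ★★★ `fpBOKernel_diag_two_sided_moment` — if `∫ρ₁(p)·∫_d|X₂(d,p)| ≤ m₂·∫ρ₁` and `∫ρ₁(p)·∫_d X(d,p)²e^{|X(d,p)|} ≤ m_R·∫ρ₁` (`X = diagX β (dud⁻¹) v v' g`, `X₁ = diagX1` its linear part,
  colour mean zero; `X₂ = X − X₁`), then `(1 − m₂)·f(1) ≤ f(u) ≤ (1 + m₂ + m_R)·f(1)`.
The moments are Gaussian moments of `ρ₁` (second/fourth moments and a small exponential moment of `β|w|²`-type quantities), `m₂, m_R = O(orbitDist(u)²)` with CONSTANT prefactors.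
HONEST FRAMING: Fubini bookkeeping; the moment inputs are OPEN (two-sided Gaussian domination of the `u = 1` diagonal integrand on the tube); femto rung R2b1 (RECORD label);
not infinite volume, not a gap, not Clay.  No defs, no named facts, no `sorry`.
-/

set_option autoImplicit false

noncomputable section

open MeasureTheory Filter Topology Real
open scoped BigOperators
open Literature.MathematicalPhysics.QuantumFieldTheory
open Literature.MathematicalPhysics.QuantumLattice

namespace Summit.QuantumFields.YangMills.Theorems.FemtoTransferGap.RateTube

open Summit.QuantumFields.YangMills.Theorems.FemtoTransferGap
open Summit.QuantumFields.YangMills.Theorems.FemtoTransferGap.TwoLattice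
open Summit.QuantumFields.YangMills.Theorems.FemtoTransferGap.TwoLattice.ConstTube
open Summit.QuantumFields.YangMills.Theorems.FemtoTransferGap.TwoLattice.Avg
open Summit.QuantumFields.YangMills.Theorems.FemtoTransferGap.TwoLattice.Cov
open Summit.QuantumFields.YangMills.Theorems.FemtoTransferGap.TwoLattice.Stiff (LinkSpace)

variable {L : ℕ} [NeZero L]

/-! ## §1 The pointwise (in the fibre datum) Haar MOMENT sandwich -/

/-- ★ For a fixed fibre/gauge datum `p = (v, v', g)`: if `d ↦ X(d) = diagX β (dud⁻¹) v v' g` and its linear part `X₁(d) = diagX1 β (slowLin (dud⁻¹)) v v' g` are bounded in `d`, then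
`1 − ∫_d|X − X₁| ≤ ∫_d e^{X} ≤ 1 + ∫_d|X − X₁| + ∫_d X²e^{|X|}` (colour mean of `X₁` is zero: `integral_diagX1_conj_eq_zero`). [cite: Luscher1983, §3] -/
theorem haar_integral_exp_diagX_moment (β : ℝ) (u : GaugeConfig 3 1 SU2) (v v' : Edge 3 L → Fin 3 → ℝ) (g : Site 3 L → SU2) {B : ℝ}
    (hXb : ∀ d : SU2, |diagX L β (gaugeTransform (fun _ : Site 3 1 => d) u) v v' g| ≤ B)
    (hX1b : ∀ d : SU2, |diagX1 L β (Toron.slowLin (gaugeTransform (fun _ : Site 3 1 => d) u)) v v' g| ≤ B) :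
    1 - ∫ d, |diagX L β (gaugeTransform (fun _ : Site 3 1 => d) u) v v' g - diagX1 L β (Toron.slowLin (gaugeTransform (fun _ : Site 3 1 => d) u)) v v' g| ∂haarProbability SU2 ≤
        ∫ d, Real.exp (diagX L β (gaugeTransform (fun _ : Site 3 1 => d) u) v v' g) ∂haarProbability SU2 ∧
      ∫ d, Real.exp (diagX L β (gaugeTransform (fun _ : Site 3 1 => d) u) v v' g) ∂haarProbability SU2 ≤
        1 + ∫ d, |diagX L β (gaugeTransform (fun _ : Site 3 1 => d) u) v v' g - diagX1 L β (Toron.slowLin (gaugeTransform (fun _ : Site 3 1 => d) u)) v v' g| ∂haarProbability SU2 +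
          ∫ d, diagX L β (gaugeTransform (fun _ : Site 3 1 => d) u) v v' g ^ 2 * Real.exp |diagX L β (gaugeTransform (fun _ : Site 3 1 => d) u) v v' g| ∂haarProbability SU2 := by
  set X₁ : SU2 → ℝ := fun d => diagX1 L β (Toron.slowLin (gaugeTransform (fun _ : Site 3 1 => d) u)) v v' g with hX₁
  set X₂ : SU2 → ℝ := fun d => diagX L β (gaugeTransform (fun _ : Site 3 1 => d) u) v v' g - X₁ d with hX₂
  have hX₁m : Measurable X₁ := measurable_diagX1_conj β u v v' g
  have hXm : Measurable (fun d : SU2 => diagX L β (gaugeTransform (fun _ : Site 3 1 => d) u) v v' g) := measurable_diagX_conj β u v v' g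
  have hX₂m : Measurable X₂ := hXm.sub hX₁m
  have hsum : ∀ d, diagX L β (gaugeTransform (fun _ : Site 3 1 => d) u) v v' g = X₁ d + X₂ d := fun d => by rw [hX₂]; ring
  have hB0 : 0 ≤ B := (abs_nonneg _).trans (hXb 1)
  have hX₂b : ∀ d, |X₂ d| ≤ 2 * B := fun d => by
    rw [hX₂]; dsimp only
    calc |diagX L β (gaugeTransform (fun _ : Site 3 1 => d) u) v v' g - X₁ d| ≤ |diagX L β (gaugeTransform (fun _ : Site 3 1 => d) u) v v' g| + |X₁ d| := abs_sub _ _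
      _ ≤ B + B := add_le_add (hXb d) (hX1b d)
      _ = 2 * B := by ring
  have hi1 : Integrable X₁ (haarProbability SU2) := integrable_of_measurable_abs_le _ hX₁m hX1b
  have hi2 : Integrable X₂ (haarProbability SU2) := integrable_of_measurable_abs_le _ hX₂m hX₂b
  have hsumb : ∀ d, |X₁ d + X₂ d| ≤ B := fun d => by rw [← hsum d]; exact hXb d
  have hiexp : Integrable (fun d => Real.exp (X₁ d + X₂ d)) (haarProbability SU2) :=
    integrable_of_measurable_abs_le _ (Real.measurable_exp.comp (hX₁m.add hX₂m)) (C := Real.exp B) fun d => by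
      rw [abs_of_pos (Real.exp_pos _)]; exact Real.exp_le_exp.mpr ((le_abs_self _).trans (hsumb d))
  have hiR : Integrable (fun d => (X₁ d + X₂ d) ^ 2 * Real.exp |X₁ d + X₂ d|) (haarProbability SU2) :=
    integrable_of_measurable_abs_le _ (((hX₁m.add hX₂m).pow_const 2).mul (Real.measurable_exp.comp (hX₁m.add hX₂m).abs)) (C := B ^ 2 * Real.exp B) fun d => by
      rw [abs_mul, abs_pow, abs_of_pos (Real.exp_pos _)]
      exact mul_le_mul (pow_le_pow_left₀ (abs_nonneg _) (hsumb d) 2) (Real.exp_le_exp.mpr (hsumb d)) (Real.exp_pos _).le (by positivity)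
  have hmean : ∫ d, X₁ d ∂haarProbability SU2 = 0 := integral_diagX1_conj_eq_zero β u v v' g
  have h := integral_exp_moment_sandwich (haarProbability SU2) hi1 hi2 hiexp hiR hmean
  simp_rw [hsum]
  refine ⟨?_, ?_⟩
  · have e : (fun d => |X₁ d + X₂ d - X₁ d|) = fun d => |X₂ d| := by funext d; ring_nf
    rw [e]; exact h.1
  · have e : (fun d => |X₁ d + X₂ d - X₁ d|) = fun d => |X₂ d| := by funext d; ring_nf
    rw [e]; exact h.2

/-! ## §2 ★★★ The two-sided diagonal comparison from moments -/

set_option maxHeartbeats 800000 in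
/-- ★★★ **(L3) FROM MOMENTS.**  For colour-blind `Ω ≥ 0` and conjugation-invariant `W ≥ 0` (bounded measurable), a slow datum `u`, a pointwise-in-`p` bound `B p` on the conjugated
exponent `X(d,p) = diagX β (dud⁻¹) v v' g` and on its linear part, and the MOMENT hypotheses against the reference density `ρ₁ = fpTriple β Ω W 1 1`:
`∫ρ₁·M₂ ≤ m₂∫ρ₁`, `∫ρ₁·M_R ≤ m_R∫ρ₁` (`M₂(p) = ∫_d|X − X₁|`, `M_R(p) = ∫_d X²e^{|X|}`), one has `(1 − m₂)·f(1) ≤ f(u) ≤ (1 + m₂ + m_R)·f(1)`,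
`f(u) = fpBOKernel β Ω W u u / K₁^{(L³β)}(u,u)`. [cite: Luscher1983, §3] -/
theorem fpBOKernel_diag_two_sided_moment {β : ℝ} {Ω : LinkSpace L → ℝ} (hΩm : Measurable Ω) {CΩ : ℝ} (hCΩ : ∀ x, |Ω x| ≤ CΩ) (hΩ0 : ∀ x, 0 ≤ Ω x)
    (hΩinv : ∀ (g : SU2) (x : LinkSpace L), Ω (adL L g x) = Ω x) {W : (Site 3 L → SU2) → ℝ} (hW : Measurable W) {CW : ℝ} (hCW : ∀ g, |W g| ≤ CW) (hW0 : ∀ g, 0 ≤ W g)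
    (hWinv : ∀ (c : SU2) (g : Site 3 L → SU2), W (fun x => c * g x * c⁻¹) = W g)
    (u : GaugeConfig 3 1 SU2) (B : (Edge 3 L → Fin 3 → ℝ) × ((Edge 3 L → Fin 3 → ℝ) × (Site 3 L → SU2)) → ℝ)
    (hXb : ∀ p (d : SU2), |diagX L β (gaugeTransform (fun _ : Site 3 1 => d) u) p.1 p.2.1 p.2.2| ≤ B p)
    (hX1b : ∀ p (d : SU2), |diagX1 L β (Toron.slowLin (gaugeTransform (fun _ : Site 3 1 => d) u)) p.1 p.2.1 p.2.2| ≤ B p)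
    {m₂ mR : ℝ}
    (hM₂i : Integrable (fun p : (Edge 3 L → Fin 3 → ℝ) × ((Edge 3 L → Fin 3 → ℝ) × (Site 3 L → SU2)) => fpTriple L β Ω W 1 1 p *
      ∫ d, |diagX L β (gaugeTransform (fun _ : Site 3 1 => d) u) p.1 p.2.1 p.2.2 - diagX1 L β (Toron.slowLin (gaugeTransform (fun _ : Site 3 1 => d) u)) p.1 p.2.1 p.2.2| ∂haarProbability SU2)
      ((orthoTransverse L).prod ((orthoTransverse L).prod (gaugeMeasure L))))
    (hMRi : Integrable (fun p : (Edge 3 L → Fin 3 → ℝ) × ((Edge 3 L → Fin 3 → ℝ) × (Site 3 L → SU2)) => fpTriple L β Ω W 1 1 p *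
      ∫ d, diagX L β (gaugeTransform (fun _ : Site 3 1 => d) u) p.1 p.2.1 p.2.2 ^ 2 * Real.exp |diagX L β (gaugeTransform (fun _ : Site 3 1 => d) u) p.1 p.2.1 p.2.2| ∂haarProbability SU2)
      ((orthoTransverse L).prod ((orthoTransverse L).prod (gaugeMeasure L))))
    (hM₂ : ∫ p, fpTriple L β Ω W 1 1 p *
        ∫ d, |diagX L β (gaugeTransform (fun _ : Site 3 1 => d) u) p.1 p.2.1 p.2.2 - diagX1 L β (Toron.slowLin (gaugeTransform (fun _ : Site 3 1 => d) u)) p.1 p.2.1 p.2.2| ∂haarProbability SU2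
        ∂((orthoTransverse L).prod ((orthoTransverse L).prod (gaugeMeasure L))) ≤
      m₂ * ∫ p, fpTriple L β Ω W 1 1 p ∂((orthoTransverse L).prod ((orthoTransverse L).prod (gaugeMeasure L))))
    (hMR : ∫ p, fpTriple L β Ω W 1 1 p *
        ∫ d, diagX L β (gaugeTransform (fun _ : Site 3 1 => d) u) p.1 p.2.1 p.2.2 ^ 2 * Real.exp |diagX L β (gaugeTransform (fun _ : Site 3 1 => d) u) p.1 p.2.1 p.2.2| ∂haarProbability SU2
        ∂((orthoTransverse L).prod ((orthoTransverse L).prod (gaugeMeasure L))) ≤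
      mR * ∫ p, fpTriple L β Ω W 1 1 p ∂((orthoTransverse L).prod ((orthoTransverse L).prod (gaugeMeasure L)))) :
    (1 - m₂) * (fpBOKernel L β Ω W 1 1 / transferKernel su2Rep ((L : ℝ) ^ 3 * β) (1 : GaugeConfig 3 1 SU2) 1) ≤
        fpBOKernel L β Ω W u u / transferKernel su2Rep ((L : ℝ) ^ 3 * β) u u ∧
      fpBOKernel L β Ω W u u / transferKernel su2Rep ((L : ℝ) ^ 3 * β) u u ≤
        (1 + m₂ + mR) * (fpBOKernel L β Ω W 1 1 / transferKernel su2Rep ((L : ℝ) ^ 3 * β) (1 : GaugeConfig 3 1 SU2) 1) := by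
  haveI := isFiniteMeasure_orthoTransverse L
  haveI : SecondCountableTopology SU2 := secondCountableTopology_su2
  set μP : Measure ((Edge 3 L → Fin 3 → ℝ) × ((Edge 3 L → Fin 3 → ℝ) × (Site 3 L → SU2))) := (orthoTransverse L).prod ((orthoTransverse L).prod (gaugeMeasure L)) with hμP
  haveI : IsFiniteMeasure μP := by rw [hμP]; infer_instance
  set K1 : ℝ := transferKernel su2Rep ((L : ℝ) ^ 3 * β) (1 : GaugeConfig 3 1 SU2) 1 with hK1
  set Ku : ℝ := transferKernel su2Rep ((L : ℝ) ^ 3 * β) u u with hKu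
  have hK1p : 0 < K1 := transferKernel_pos _ _ _ _
  have hKup : 0 < Ku := transferKernel_pos _ _ _ _
  -- abbreviations for the exponent and the two Haar moments
  set X : SU2 → ((Edge 3 L → Fin 3 → ℝ) × ((Edge 3 L → Fin 3 → ℝ) × (Site 3 L → SU2))) → ℝ :=
    fun d p => diagX L β (gaugeTransform (fun _ : Site 3 1 => d) u) p.1 p.2.1 p.2.2 with hXdef
  set M₂ : ((Edge 3 L → Fin 3 → ℝ) × ((Edge 3 L → Fin 3 → ℝ) × (Site 3 L → SU2))) → ℝ :=
    fun p => ∫ d, |diagX L β (gaugeTransform (fun _ : Site 3 1 => d) u) p.1 p.2.1 p.2.2 - diagX1 L β (Toron.slowLin (gaugeTransform (fun _ : Site 3 1 => d) u)) p.1 p.2.1 p.2.2| ∂haarProbability SU2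
    with hM₂def
  set MR : ((Edge 3 L → Fin 3 → ℝ) × ((Edge 3 L → Fin 3 → ℝ) × (Site 3 L → SU2))) → ℝ :=
    fun p => ∫ d, diagX L β (gaugeTransform (fun _ : Site 3 1 => d) u) p.1 p.2.1 p.2.2 ^ 2 * Real.exp |diagX L β (gaugeTransform (fun _ : Site 3 1 => d) u) p.1 p.2.1 p.2.2| ∂haarProbability SU2
    with hMRdef
  -- the reference density `ρ = fpTriple(1,1)/K1 ≥ 0`
  set ρ : ((Edge 3 L → Fin 3 → ℝ) × ((Edge 3 L → Fin 3 → ℝ) × (Site 3 L → SU2))) → ℝ := fun p => fpTriple L β Ω W 1 1 p / K1 with hρ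
  obtain ⟨Bρ, hBρ⟩ := abs_fpTriple_le (L := L) β hCΩ hCW (1 : GaugeConfig 3 1 SU2) 1
  have hρm : Measurable ρ := (measurable_fpTriple β hΩm hW 1 1).div_const _
  have hρ0 : ∀ p, 0 ≤ ρ p := fun p => by
    rw [hρ]; dsimp only; unfold fpTriple
    exact div_nonneg (mul_nonneg (hΩ0 _) (mul_nonneg (mul_nonneg (hW0 _) (transferKernel_pos _ _ _ _).le) (hΩ0 _))) hK1p.le
  have hρb : ∀ p, |ρ p| ≤ Bρ / K1 := fun p => by rw [hρ]; dsimp only; rw [abs_div, abs_of_pos hK1p]; exact div_le_div_of_nonneg_right (hBρ p) hK1p.le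
  have hρint : Integrable ρ μP := integrable_of_measurable_abs_le _ hρm hρb
  -- f(1) = ∫ ρ
  have hf1 : fpBOKernel L β Ω W 1 1 / K1 = ∫ p, ρ p ∂μP := by
    rw [hρ, integral_div, hμP, ← fpBOKernel_eq_integral_prod β hΩm hCΩ hW hCW]
  -- f(u) = ∫_d ∫_p ρ·exp(X d p)
  have hfu_conj : ∀ d : SU2, fpBOKernel L β Ω W (gaugeTransform (fun _ : Site 3 1 => d) u) (gaugeTransform (fun _ : Site 3 1 => d) u) / Ku =
      ∫ p, ρ p * Real.exp (X d p) ∂μP := fun d => by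
    rw [hμP, fpBOKernel_eq_integral_prod β hΩm hCΩ hW hCW, ← integral_div]
    refine integral_congr_ae (ae_of_all _ fun p => ?_)
    dsimp only
    rw [hKu, fpTriple_conj_div_eq, hρ]
  have hfu : fpBOKernel L β Ω W u u / Ku = ∫ d, ∫ p, ρ p * Real.exp (X d p) ∂μP ∂haarProbability SU2 := by
    have hconst : ∀ d : SU2, fpBOKernel L β Ω W (gaugeTransform (fun _ : Site 3 1 => d) u) (gaugeTransform (fun _ : Site 3 1 => d) u) / Ku = fpBOKernel L β Ω W u u / Ku :=
      fun d => by rw [fpBOKernel_conj β hΩm hΩinv hW hWinv d u u]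
    simp_rw [← hfu_conj, hconst]
    simp
  -- the joint integrand and Fubini (as in the sup version: `G` is uniformly bounded)
  set G : SU2 × ((Edge 3 L → Fin 3 → ℝ) × ((Edge 3 L → Fin 3 → ℝ) × (Site 3 L → SU2))) → ℝ := fun q => ρ q.2 * Real.exp (X q.1 q.2) with hG
  have hGeq : ∀ q : SU2 × ((Edge 3 L → Fin 3 → ℝ) × ((Edge 3 L → Fin 3 → ℝ) × (Site 3 L → SU2))),
      G q = fpTriple L β Ω W (gaugeTransform (fun _ : Site 3 1 => q.1) u) (gaugeTransform (fun _ : Site 3 1 => q.1) u) q.2 / Ku := fun q => by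
    rw [hG]; dsimp only; rw [hKu, fpTriple_conj_div_eq, hρ]
  have hGm : Measurable G := by
    have hfun : G = fun q : SU2 × ((Edge 3 L → Fin 3 → ℝ) × ((Edge 3 L → Fin 3 → ℝ) × (Site 3 L → SU2))) =>
        fpTriple L β Ω W (gaugeTransform (fun _ : Site 3 1 => q.1) u) (gaugeTransform (fun _ : Site 3 1 => q.1) u) q.2 / Ku := funext hGeq
    rw [hfun]
    refine Measurable.div_const ?_ _
    have hK : Measurable fun r : GaugeConfig 3 L SU2 × GaugeConfig 3 L SU2 => transferKernel su2Rep β r.1 r.2 :=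
      (continuous_transferKernel su2Rep continuous_su2Rep β).measurable
    have hc : Measurable fun q : SU2 × ((Edge 3 L → Fin 3 → ℝ) × ((Edge 3 L → Fin 3 → ℝ) × (Site 3 L → SU2))) => gaugeTransform (fun _ : Site 3 1 => q.1) u :=
      (measurable_constGaugeAction_left (L := 1) u).comp measurable_fst
    have hU : Measurable fun q : SU2 × ((Edge 3 L → Fin 3 → ℝ) × ((Edge 3 L → Fin 3 → ℝ) × (Site 3 L → SU2))) =>
        orthoTube L (gaugeTransform (fun _ : Site 3 1 => q.1) u) q.2.1 := by
      have h := (measurable_orthoTube L).comp (hc.prodMk (measurable_fst.comp measurable_snd))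
      simpa only [Function.comp_def] using h
    have hV : Measurable fun q : SU2 × ((Edge 3 L → Fin 3 → ℝ) × ((Edge 3 L → Fin 3 → ℝ) × (Site 3 L → SU2))) =>
        gaugeTransform q.2.2.2 (orthoTube L (gaugeTransform (fun _ : Site 3 1 => q.1) u) q.2.2.1) := by
      have h1 : Measurable fun q : SU2 × ((Edge 3 L → Fin 3 → ℝ) × ((Edge 3 L → Fin 3 → ℝ) × (Site 3 L → SU2))) =>
          orthoTube L (gaugeTransform (fun _ : Site 3 1 => q.1) u) q.2.2.1 := by
        have h := (measurable_orthoTube L).comp (hc.prodMk (measurable_fst.comp (measurable_snd.comp measurable_snd)))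
        simpa only [Function.comp_def] using h
      have h := (measurable_gaugeAction (L := L)).comp (h1.prodMk (measurable_snd.comp (measurable_snd.comp measurable_snd)))
      simpa only [Function.comp_def] using h
    have hKq : Measurable fun q : SU2 × ((Edge 3 L → Fin 3 → ℝ) × ((Edge 3 L → Fin 3 → ℝ) × (Site 3 L → SU2))) =>
        transferKernel su2Rep β (orthoTube L (gaugeTransform (fun _ : Site 3 1 => q.1) u) q.2.1)
          (gaugeTransform q.2.2.2 (orthoTube L (gaugeTransform (fun _ : Site 3 1 => q.1) u) q.2.2.1)) := by
      have h := hK.comp (hU.prodMk hV); simpa only [Function.comp_def] using h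
    unfold fpTriple
    exact (hΩm.comp ((measurable_linkEmbed L).comp (measurable_fst.comp measurable_snd))).mul
      (((hW.comp (measurable_snd.comp (measurable_snd.comp measurable_snd))).mul hKq).mul
        (hΩm.comp ((measurable_linkEmbed L).comp (measurable_fst.comp (measurable_snd.comp measurable_snd)))))
  obtain ⟨M, hM⟩ := exists_transferKernel_le su2Rep continuous_su2Rep β (L := L)
  have hCΩ0 : 0 ≤ CΩ := (abs_nonneg _).trans (hCΩ 0)
  have hCW0 : 0 ≤ CW := (abs_nonneg _).trans (hCW 1)
  have hM0 : 0 ≤ M := (transferKernel_pos su2Rep β (1 : GaugeConfig 3 L SU2) 1).le.trans (hM 1 1)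
  have habs : ∀ (w w' : GaugeConfig 3 1 SU2) (q : (Edge 3 L → Fin 3 → ℝ) × ((Edge 3 L → Fin 3 → ℝ) × (Site 3 L → SU2))), |fpTriple L β Ω W w w' q| ≤ CΩ * ((CW * M) * CΩ) :=
    fun w w' q => by
      unfold fpTriple
      rw [abs_mul, abs_mul, abs_mul, abs_of_pos (transferKernel_pos su2Rep β _ _)]
      exact mul_le_mul (hCΩ _) (mul_le_mul (mul_le_mul (hCW _) (hM _ _) (transferKernel_pos su2Rep β _ _).le hCW0) (hCΩ _) (abs_nonneg _) (mul_nonneg hCW0 hM0))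
        (mul_nonneg (mul_nonneg (abs_nonneg _) (transferKernel_pos su2Rep β _ _).le) (abs_nonneg _)) hCΩ0
  have hGb : ∀ q, |G q| ≤ CΩ * ((CW * M) * CΩ) / Ku := fun q => by
    rw [hGeq, abs_div, abs_of_pos hKup]; exact div_le_div_of_nonneg_right (habs _ _ _) hKup.le
  have hGint : Integrable G ((haarProbability SU2).prod μP) := integrable_of_measurable_abs_le _ hGm hGb
  have hswap : ∫ d, ∫ p, ρ p * Real.exp (X d p) ∂μP ∂haarProbability SU2 = ∫ p, ∫ d, G (d, p) ∂haarProbability SU2 ∂μP := by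
    have h := integral_integral_swap (f := fun d p => G (d, p)) hGint
    simpa only [hG] using h
  have hinner_int : Integrable (fun p => ∫ d, G (d, p) ∂haarProbability SU2) μP := hGint.swap.integral_prod_left
  -- the pointwise MOMENT sandwich in `p`
  have hpt : ∀ p, (1 - M₂ p) * ρ p ≤ ∫ d, G (d, p) ∂haarProbability SU2 ∧ ∫ d, G (d, p) ∂haarProbability SU2 ≤ (1 + M₂ p + MR p) * ρ p := by
    intro p
    have hI : ∫ d, G (d, p) ∂haarProbability SU2 = ρ p * ∫ d, Real.exp (X d p) ∂haarProbability SU2 := by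
      rw [hG]; dsimp only; rw [integral_const_mul]
    rw [hI]
    have hsand := haar_integral_exp_diagX_moment (L := L) β u p.1 p.2.1 p.2.2 (hXb p) (hX1b p)
    have hρp0 : 0 ≤ ρ p := hρ0 p
    constructor
    · calc (1 - M₂ p) * ρ p = ρ p * (1 - M₂ p) := mul_comm _ _
        _ ≤ ρ p * ∫ d, Real.exp (X d p) ∂haarProbability SU2 := mul_le_mul_of_nonneg_left (by rw [hM₂def]; exact hsand.1) hρp0
    · calc ρ p * ∫ d, Real.exp (X d p) ∂haarProbability SU2 ≤ ρ p * (1 + M₂ p + MR p) := mul_le_mul_of_nonneg_left (by rw [hM₂def, hMRdef]; exact hsand.2) hρp0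
        _ = (1 + M₂ p + MR p) * ρ p := mul_comm _ _
  -- the moment hypotheses in `ρ`-currency
  have hM₂i' : Integrable (fun p => ρ p * M₂ p) μP := by
    have h := hM₂i.div_const K1
    refine h.congr (ae_of_all _ fun p => ?_)
    dsimp only; rw [hρ]; dsimp only; rw [hM₂def]; ring
  have hMRi' : Integrable (fun p => ρ p * MR p) μP := by
    have h := hMRi.div_const K1
    refine h.congr (ae_of_all _ fun p => ?_)
    dsimp only; rw [hρ]; dsimp only; rw [hMRdef]; ring
  have hM₂' : ∫ p, ρ p * M₂ p ∂μP ≤ m₂ * ∫ p, ρ p ∂μP := by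
    have e1 : ∫ p, ρ p * M₂ p ∂μP = (∫ p, fpTriple L β Ω W 1 1 p * M₂ p ∂μP) / K1 := by
      rw [← integral_div]; refine integral_congr_ae (ae_of_all _ fun p => ?_); dsimp only; rw [hρ]; dsimp only; ring
    have e2 : ∫ p, ρ p ∂μP = (∫ p, fpTriple L β Ω W 1 1 p ∂μP) / K1 := by rw [hρ, integral_div]
    rw [e1, e2, ← mul_div_assoc]
    exact div_le_div_of_nonneg_right (by rw [hM₂def, hμP]; exact hM₂) hK1p.le
  have hMR' : ∫ p, ρ p * MR p ∂μP ≤ mR * ∫ p, ρ p ∂μP := by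
    have e1 : ∫ p, ρ p * MR p ∂μP = (∫ p, fpTriple L β Ω W 1 1 p * MR p ∂μP) / K1 := by
      rw [← integral_div]; refine integral_congr_ae (ae_of_all _ fun p => ?_); dsimp only; rw [hρ]; dsimp only; ring
    have e2 : ∫ p, ρ p ∂μP = (∫ p, fpTriple L β Ω W 1 1 p ∂μP) / K1 := by rw [hρ, integral_div]
    rw [e1, e2, ← mul_div_assoc]
    exact div_le_div_of_nonneg_right (by rw [hMRdef, hμP]; exact hMR) hK1p.le
  -- integrate
  rw [hfu, hswap, hf1]
  constructor
  · have hlow : Integrable (fun p => (1 - M₂ p) * ρ p) μP := by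
      have h : Integrable (fun p => ρ p - ρ p * M₂ p) μP := hρint.sub hM₂i'
      refine h.congr (ae_of_all _ fun p => ?_); dsimp only; ring
    calc (1 - m₂) * ∫ p, ρ p ∂μP = ∫ p, ρ p ∂μP - m₂ * ∫ p, ρ p ∂μP := by ring
      _ ≤ ∫ p, ρ p ∂μP - ∫ p, ρ p * M₂ p ∂μP := by linarith [hM₂']
      _ = ∫ p, (1 - M₂ p) * ρ p ∂μP := by
          rw [← integral_sub hρint hM₂i']; refine integral_congr_ae (ae_of_all _ fun p => ?_); dsimp only; ring
      _ ≤ ∫ p, ∫ d, G (d, p) ∂haarProbability SU2 ∂μP := integral_mono hlow hinner_int fun p => (hpt p).1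
  · have hI1 : Integrable (fun p => ρ p + ρ p * M₂ p) μP := hρint.add hM₂i'
    have hup : Integrable (fun p => (1 + M₂ p + MR p) * ρ p) μP := by
      have h : Integrable (fun p => (ρ p + ρ p * M₂ p) + ρ p * MR p) μP := hI1.add hMRi'
      refine h.congr (ae_of_all _ fun p => ?_); dsimp only; ring
    calc ∫ p, ∫ d, G (d, p) ∂haarProbability SU2 ∂μP ≤ ∫ p, (1 + M₂ p + MR p) * ρ p ∂μP := integral_mono hinner_int hup fun p => (hpt p).2
      _ = ∫ p, ((ρ p + ρ p * M₂ p) + ρ p * MR p) ∂μP := integral_congr_ae (ae_of_all _ fun p => by dsimp only; ring)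
      _ = ∫ p, ρ p ∂μP + ∫ p, ρ p * M₂ p ∂μP + ∫ p, ρ p * MR p ∂μP := by rw [integral_add hI1 hMRi', integral_add hρint hM₂i']
      _ ≤ (1 + m₂ + mR) * ∫ p, ρ p ∂μP := by nlinarith [hM₂', hMR']

end Summit.QuantumFields.YangMills.Theorems.FemtoTransferGap.RateTube

end
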